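import Summits.HodgeConjecture.CorCM.Census.CyclicCharacterSpectator

/-!
# Cyclic characters, XXIII: THE CYCLIC-SYLOW LAW — `μ(G, c) = β(G, c) − 1` for every finite group with `G / ker w ≅ ℤ/2ᵏ` (`k ≥ 2`) and odd kernel

COR-CM (cell `pub-hodgecm2`), count-neutral kernel combinatorics by the binder seat b09 (gen 42; lane CYCLIC-CHARACTER FIBRE LAW, part XXIII), on parts XVI–XXII BY
NAME.  Theorems only (no definition, no `decide`, no certificate, no named fact, no `sorry`).
HONEST FRAMING: `HC_CM` is NOT proved, here or anywhere in the tree; nothing here is a period or a headline.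

**THE LAW (`isLeast_card_gfaces_generate_of_cyclic`, `…_card_block`).**  Let `G` be finite, `c` a central involution, `w : G ↠ ℤ/2ᵏ` additive (`k ≥ 2`) with
`w c ≠ 0`, the kernel consisting of odd-order elements and non-trivial — equivalently (Burnside) `|G| = 2ᵏ·odd > 2ᵏ` with CYCLIC Sylow `2`-subgroup and central
involution: `N ⋊ ℤ/2ᵏ` for every odd-order `N`, abelian or not, and every action whose `2ᵏ⁻¹`-th power is trivial; the dicyclic, metacyclic (`ℤ/m ⋊ ℤ/2ᵏ`),
quartic / octic twist columns of this directory and gen 41ʼs whole «odd-kernel» class.  Then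
**`μ(G, c) = φ₂(G, c) = β(G, c) − 1`**: the least number of rank-four face relations whose base changes generate, with the pairs, the integer Hodge lattice is
the number of blocks less one.

PROOF.  As in part XIX (`k = 2`), with `2ᵏ⁻¹ − 2` SPECTATOR equator faces in addition: gen 38ʼs cover of the `β − 2ᵏ⁻¹ − 1` far blocks (§1: the near zone has the
`2ᵏ⁻¹ + 1` blocks arc ∕ flips at position `j`, `j < 2ᵏ⁻¹`), the two equator faces of the bottom walk (relations `R(B')`, `ζ`; hence (W2) and, by `ζ·Q`, the arc shift
of the TOP position, §2), and for every interior position `1 ≤ j ≤ 2ᵏ⁻¹ − 2` the three-across face carried by a spectator `u_j` (part XXII: the UNIT arc shift at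
position `j`); unit shifts telescope to the arc shifts `Y(u)` of part XVI, whose exact META (`|S₀| ≤ β − 1 = φ₂`) closes.  `2 + (2ᵏ⁻¹ − 2) = 2ᵏ⁻¹ = 2ᵏ⁻¹ − 1 + d` closing
faces, as gen 41ʼs numerics predicted.
-/

namespace Summit.HodgeConjecture.CorCM.Census.CyclicCharacter

open Finset
open Summit.HodgeConjecture.CorCM.Prior.AllgGroup.RfwfAllgGroup
open Summit.HodgeConjecture.CorCM.Census.BlockParity
open Summit.HodgeConjecture.CorCM.Census.Coinvariant
open Summit.HodgeConjecture.CorCM.Census.TwistGeneration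
open Summit.HodgeConjecture.CorCM.Census.Nondegenerate
open Summit.HodgeConjecture.CorCM.Census.BaseBlock
open Summit.HodgeConjecture.CorCM.Census.Splitting

noncomputable section

variable {G : Type*} [Group G] [Fintype G] [DecidableEq G] {k : ℕ} {w : G → ZMod (2 ^ k)} {c : G}

/-! ## §1 Positions: values, and the `2ᵏ⁻¹ + 1` near blocks -/

omit [Fintype G] [DecidableEq G] in
/-- A natural number below `2ᵏ` is its own value in `ℤ/2ᵏ`. [folklore] -/
theorem val_natCast_of_lt {j : ℕ} (hj : j < 2 ^ k) : ((j : ZMod (2 ^ k))).val = j := by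
  rw [ZMod.val_natCast, Nat.mod_eq_of_lt hj]

/-- **A point with `w u = j`, `j < 2ᵏ⁻¹`, lies in `T_0`; with `1 ≤ j ≤ 2ᵏ⁻¹` it lies in `T_1`.** [folklore] -/
theorem mem_arcType_of_apply_eq_natCast (hw : ∀ P Q : G, w (P * Q) = w P + w Q) (hk : 1 ≤ k) (hc2 : c * c = 1) (hwc : w c ≠ 0) {u : G} {j : ℕ}
    (hu : w u = (j : ZMod (2 ^ k))) (hj : j < 2 ^ (k - 1)) :
    u ∈ (arcType hw hk hc2 hwc 0).1 ∧ (1 ≤ j → u ∈ (arcType hw hk hc2 hwc 1).1) := by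
  have h2k : 2 ^ k = 2 * 2 ^ (k - 1) := by rw [← pow_succ', Nat.sub_add_cancel hk]
  refine ⟨by rw [mem_arcType, hu, sub_zero, val_natCast_of_lt (by omega)]; exact hj, fun hj1 => ?_⟩
  rw [mem_arcType, hu, show (j : ZMod (2 ^ k)) - 1 = ((j - 1 : ℕ) : ZMod (2 ^ k)) by rw [Nat.cast_sub hj1, Nat.cast_one],
    val_natCast_of_lt (by omega)]
  omega

/-- `(j : ℤ/2ᵏ) ≠ 0` for `1 ≤ j < 2ᵏ`. [folklore] -/
theorem natCast_ne_zero_of_lt {j : ℕ} (hj1 : 1 ≤ j) (hj : j < 2 ^ k) : (j : ZMod (2 ^ k)) ≠ 0 := by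
  intro h
  have := congrArg ZMod.val h
  rw [val_natCast_of_lt hj, ZMod.val_zero] at this
  omega

/-- **AT LEAST `2ᵏ⁻¹ + 1` NEAR BLOCKS**: the arc block and the blocks of the flips of `T_0` at the positions `0, …, 2ᵏ⁻¹ − 1` are pairwise distinct
(kernel with an element of odd order `≠ 1`, `w` onto). [folklore] -/
theorem half_add_one_le_card_filter_bpot_le_one (hw : ∀ P Q : G, w (P * Q) = w P + w Q) (hk : 1 ≤ k) (hc2 : c * c = 1)
    (hcen : ∀ x : G, x * c = c * x) (hwc : w c ≠ 0) (h1 : ∃ g₁ : G, w g₁ = 1) {n₀ : G} (hn1 : n₀ ≠ 1) (hn2 : n₀ * n₀ ≠ 1) (hn : w n₀ = 0) :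
    2 ^ (k - 1) + 1 ≤ (univ.filter fun Bk : Block c => bpot c (arcType hw hk hc2 hwc 0) Bk.out ≤ 1).card := by
  have h2k : 2 ^ k = 2 * 2 ^ (k - 1) := by rw [← pow_succ', Nat.sub_add_cancel hk]
  -- a point at every position
  have hpt : ∀ j : ℕ, ∃ u : G, w u = (j : ZMod (2 ^ k)) := fun j => exists_apply_eq hw h1 _
  choose pt hpt using hpt
  set blkAt : ℕ → Block c := fun j => blk c (oflipCM c hc2 (pt j) (arcType hw hk hc2 hwc 0)) with hblkAt
  have hinj : Set.InjOn blkAt ↑(range (2 ^ (k - 1))) := by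
    intro j hj j' hj' h
    have hj : j < 2 ^ (k - 1) := mem_range.mp hj
    have hj' : j' < 2 ^ (k - 1) := mem_range.mp hj'
    have h2 := (blk_oflipCM_arcType_eq_iff hw hk hc2 hwc hn1 hn2 hn h1 0 0 (pt j) (pt j')).mp h
    rw [hpt, hpt, sub_zero, sub_zero, two_nsmul, two_nsmul, ← Nat.cast_add, ← Nat.cast_add] at h2
    have h3 := congrArg ZMod.val h2
    rw [val_natCast_of_lt (by omega), val_natCast_of_lt (by omega)] at h3
    omega
  have hpot1 : ∀ j < 2 ^ (k - 1), bpot c (arcType hw hk hc2 hwc 0) (blkAt j).out = 1 := fun j hj => by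
    rw [hblkAt, bpot_out]
    exact bpot_oflipCM_arcType_eq_one hw hk hc2 hcen hwc hn1 hn (mem_arcType_of_apply_eq_natCast hw hk hc2 hwc (hpt j) hj).1
  have hpot0 : bpot c (arcType hw hk hc2 hwc 0) (blk c (arcType hw hk hc2 hwc 0)).out = 0 := by
    rw [bpot_out]; have := bpot_rt_base c (arcType hw hk hc2 hwc 0) 1; rwa [rt_one] at this
  have hnot : blk c (arcType hw hk hc2 hwc 0) ∉ (range (2 ^ (k - 1))).image blkAt := by
    rw [mem_image]
    rintro ⟨j, hj, h⟩
    have := hpot1 j (mem_range.mp hj)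
    rw [h, hpot0] at this
    exact zero_ne_one this
  calc 2 ^ (k - 1) + 1 = (insert (blk c (arcType hw hk hc2 hwc 0)) ((range (2 ^ (k - 1))).image blkAt)).card := by
        rw [card_insert_of_notMem hnot, card_image_of_injOn hinj, card_range]
    _ ≤ _ := card_le_card fun B hB => by
        rw [mem_filter]
        refine ⟨mem_univ _, ?_⟩
        rcases mem_insert.mp hB with rfl | hB
        · rw [hpot0]; exact Nat.zero_le 1
        · obtain ⟨j, hj, rfl⟩ := mem_image.mp hB
          rw [hpot1 j (mem_range.mp hj)]

/-! ## §2 The top arc shift from `ζ`, any `k` -/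

/-- **THE TOP ARC SHIFT FROM `ζ`** (any `k ≥ 1`): for `w t = 0`, `w u = 2ᵏ⁻¹ − 1` and `ζ_t ∈ ℤ⟨pairs⟩ + ℤ[G]·S`, the arc-shift vector of the top point `u` lies
in `ℤ⟨pairs⟩ + ℤ[G]·S` — it is `pair(T_0^{(u)}) − pair(T_0) − ζ_t·Q` with `w Q = 1 − 2ᵏ⁻¹`, `T_{2ᵏ⁻¹} = T_0·c`. [folklore] -/
theorem shiftTop_mem_of_zeta_mem (hw : ∀ P Q : G, w (P * Q) = w P + w Q) (hk : 1 ≤ k) (hc2 : c * c = 1) (hcen : ∀ x : G, x * c = c * x)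
    (hwc : w c ≠ 0) (S : Finset (CMF G c →₀ ℤ)) {t u : G} (ht : w t = 0) (hu : w u = ((2 ^ (k - 1) : ℕ) : ZMod (2 ^ k)) - 1)
    (h : (Finsupp.single (oflipCM c hc2 t (arcType hw hk hc2 hwc 0)) (1 : ℤ) - Finsupp.single (arcType hw hk hc2 hwc 0) 1) + (Finsupp.single (oflipCM c hc2 t (arcType hw hk hc2 hwc 1)) (1 : ℤ) - Finsupp.single (arcType hw hk hc2 hwc 1) 1) ∈ Submodule.span ℤ (pairSet c) ⊔ Submodule.span ℤ (translates c S)) :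
    Finsupp.single (oflipCM c hc2 u (arcType hw hk hc2 hwc 0)) (1 : ℤ) - Finsupp.single (arcType hw hk hc2 hwc 0) 1 -
        Finsupp.single (oflipCM c hc2 u (arcType hw hk hc2 hwc (w u))) 1 + Finsupp.single (arcType hw hk hc2 hwc (w u)) 1 ∈ Submodule.span ℤ (pairSet c) ⊔ Submodule.span ℤ (translates c S) := by
  have hhalf := half_add_half hk
  have e2 : (0 : ZMod (2 ^ k)) - w c = ((2 ^ (k - 1) : ℕ) : ZMod (2 ^ k)) := by
    rw [apply_c hw hk hc2 hwc, zero_sub, neg_eq_iff_add_eq_zero, hhalf]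
  have hQ : w (u⁻¹ * t) = -(((2 ^ (k - 1) : ℕ) : ZMod (2 ^ k)) - 1) := by rw [hw, map_inv hw, hu, ht, add_zero]
  have eu : t * (u⁻¹ * t)⁻¹ = u := by rw [mul_inv_rev, inv_inv, mul_inv_cancel_left]
  have h' := mapDomain_rt_mem_psp c hcen (u⁻¹ * t) S h
  simp only [Finsupp.mapDomain_add, Finsupp.mapDomain_sub, Finsupp.mapDomain_single, rt_oflipCM, rt_arcType, hQ, eu, sub_neg_eq_add, zero_add] at h'
  rw [show (1 : ZMod (2 ^ k)) + (((2 ^ (k - 1) : ℕ) : ZMod (2 ^ k)) - 1) = ((2 ^ (k - 1) : ℕ) : ZMod (2 ^ k)) by abel] at h'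
  have hcinv : c⁻¹ = c := inv_eq_of_mul_eq_one_right hc2
  have hp1 : pair c (oflipCM c hc2 u (arcType hw hk hc2 hwc 0)) = Finsupp.single (oflipCM c hc2 u (arcType hw hk hc2 hwc 0)) 1 + Finsupp.single (oflipCM c hc2 u (arcType hw hk hc2 hwc ((2 ^ (k - 1) : ℕ) : ZMod (2 ^ k)))) 1 := by
    rw [pair, rt_oflipCM, rt_arcType, e2, hcinv, hcen, oflipCM_cmul]
  have hp0 : pair c (arcType hw hk hc2 hwc 0) = Finsupp.single (arcType hw hk hc2 hwc 0) 1 + Finsupp.single (arcType hw hk hc2 hwc ((2 ^ (k - 1) : ℕ) : ZMod (2 ^ k))) 1 := by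
    rw [pair, rt_arcType, e2]
  have hP1 : pair c (oflipCM c hc2 u (arcType hw hk hc2 hwc 0)) ∈ Submodule.span ℤ (pairSet c) ⊔ Submodule.span ℤ (translates c S) := Submodule.mem_sup_left (Submodule.subset_span (pair_mem_pairSet c _))
  have hP0 : pair c (arcType hw hk hc2 hwc 0) ∈ Submodule.span ℤ (pairSet c) ⊔ Submodule.span ℤ (translates c S) := Submodule.mem_sup_left (Submodule.subset_span (pair_mem_pairSet c _))
  rw [hp1] at hP1
  rw [hp0] at hP0
  rw [hu]
  have hres := Submodule.sub_mem _ (Submodule.sub_mem _ hP1 hP0) h'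
  convert hres using 1
  abel

/-! ## §3 THE CYCLIC-SYLOW LAW -/

/-- **THE CYCLIC-SYLOW LAW: `μ(G, c) = φ₂(G, c)` and `φ₂(G, c) + 1 = β(G, c)`** for every finite `G` with a central involution `c` and an additive
`w : G ↠ ℤ/2ᵏ` (`k ≥ 2`), `w c ≠ 0`, whose kernel consists of odd-order elements and is non-trivial. [folklore] -/
theorem isLeast_card_gfaces_generate_of_cyclic [Fintype (CMF G c)] (hw : ∀ P Q : G, w (P * Q) = w P + w Q) (hk : 1 ≤ k) (hk2 : 2 ≤ k)
    (hc2 : c * c = 1) (hcen : ∀ x : G, x * c = c * x) (hwc : w c ≠ 0) (h1 : ∃ g₁ : G, w g₁ = 1)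
    (hodd : ∀ g : G, w g = 0 → Odd (orderOf g)) {n₀ : G} (hn₀ : w n₀ = 0) (hn₀1 : n₀ ≠ 1) :
    IsLeast {n : ℕ | ∃ S : Finset (CMF G c →₀ ℤ), (↑S ⊆ gfaceSet G c hc2) ∧ S.card = n ∧
      hodgeSpan c hc2 ≤ Submodule.span ℤ (pairSet c) ⊔ Submodule.span ℤ (translates c S)} (fibreTwo c hc2) ∧
    fibreTwo c hc2 + 1 = Fintype.card (Block c) := by
  have h2k : 2 ^ k = 2 * 2 ^ (k - 1) := by rw [← pow_succ', Nat.sub_add_cancel hk]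
  have hh2 : 2 ≤ 2 ^ (k - 1) := by
    calc 2 = 2 ^ 1 := (pow_one 2).symm
      _ ≤ 2 ^ (k - 1) := Nat.pow_le_pow_right (by norm_num) (by omega)
  have hβ := fibreTwo_add_one_eq_card_block_of_odd hw hk2 h1 hc2 hcen hwc hodd
  refine ⟨?_, hβ⟩
  have hn₀2 : n₀ * n₀ ≠ 1 := mul_self_ne_one_of_odd (hodd n₀ hn₀) hn₀1
  obtain ⟨m, hm⟩ := odd_card_ker hw hodd
  have h3 := three_le_card_ker hw hodd hn₀ hn₀1
  have hm1 : 1 ≤ m := by omega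
  -- `B' ⊆ F_0` of size `m`, `b ∈ B'`, `t ≠ t' ∈ F_0 ∖ B'`
  obtain ⟨B', hB'F, hB'c⟩ := exists_subset_card_eq (s := (univ.filter fun s : G => w s = 0)) (n := m) (by omega)
  obtain ⟨b, hb⟩ : B'.Nonempty := by rw [← card_pos]; omega
  have hUc : ((univ.filter fun s : G => w s = 0) \ B').card = m + 1 := by have := card_sdiff_add_card_eq_card hB'F; omega
  obtain ⟨t, ht, t', ht', htt'⟩ := one_lt_card.mp (by omega : 1 < ((univ.filter fun s : G => w s = 0) \ B').card)
  have ht0 : w t = 0 := (mem_filter.mp (mem_sdiff.mp ht).1).2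
  have ht'0 : w t' = 0 := (mem_filter.mp (mem_sdiff.mp ht').1).2
  have htB : t ∉ B' := (mem_sdiff.mp ht).2
  have ht'B : t' ∉ B' := (mem_sdiff.mp ht').2
  have hb0 : w b = 0 := (mem_filter.mp (hB'F hb)).2
  have hsmall : 2 * B'.card < ((univ.filter fun s : G => w s = 0)).card := by omega
  have hlarge : 2 * (((univ.filter fun s : G => w s = 0)).card - B'.card - 1) < ((univ.filter fun s : G => w s = 0)).card := by omega
  have hmeq : 2 * B'.card + 1 = ((univ.filter fun s : G => w s = 0)).card := by omega
  -- the equator types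
  obtain ⟨X₃, hX₃⟩ := exists_sdiff_eq_of_subset_fibre hw hk hc2 hwc B' hB'F
  obtain ⟨X₁, hX₁⟩ := exists_sdiff_eq_of_subset_fibre hw hk hc2 hwc (B'.erase b) ((erase_subset b B').trans hB'F)
  have hwc' : ∀ x : G, w x = 0 → ∀ y : G, w y = 0 → y ≠ c * x := by
    intro x hx y hy h
    apply hwc
    have := congrArg w h
    rw [hw, hx, hy, add_zero] at this
    exact this.symm
  have ht'orb : t' ∉ orb c t := by
    rw [mem_orb]; push Not; exact ⟨htt'.symm, hwc' t ht0 t' ht'0⟩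
  have htorb : t ∉ orb c b := by
    rw [mem_orb]; push Not; exact ⟨fun h => htB (h ▸ hb), hwc' b hb0 t ht0⟩
  -- spectators: a point at every position
  have hpt : ∀ j : ℕ, ∃ u : G, w u = (j : ZMod (2 ^ k)) := fun j => exists_apply_eq hw h1 _
  choose pt hpt using hpt
  have hptT : ∀ j, 1 ≤ j → j ≤ 2 ^ (k - 1) - 2 →
      pt j ∈ (arcType hw hk hc2 hwc 0).1 ∧ pt j ∈ (arcType hw hk hc2 hwc 1).1 ∧ w (pt j) ≠ 0 ∧ pt j ∈ X₃.1 := by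
    intro j hj1 hj2
    have hm := mem_arcType_of_apply_eq_natCast hw hk hc2 hwc (hpt j) (by omega)
    have hne : w (pt j) ≠ 0 := by rw [hpt]; exact natCast_ne_zero_of_lt hj1 (by omega)
    refine ⟨hm.1, hm.2 hj1, hne, ?_⟩
    by_contra h
    have : pt j ∈ (arcType hw hk hc2 hwc 0).1 \ X₃.1 := mem_sdiff.mpr ⟨hm.1, h⟩
    rw [hX₃] at this
    exact hne (mem_filter.mp (hB'F this)).2
  set g : ℕ → (CMF G c →₀ ℤ) := fun j => gface c hc2 (oflipCM c hc2 (pt j) X₃) t t' with hg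
  set Gs : Finset (CMF G c →₀ ℤ) := (Icc 1 (2 ^ (k - 1) - 2)).image g with hGs
  -- the cover of the far blocks
  obtain ⟨Sc, hScf, hScc, -, -, -, htwc⟩ := exists_joint_cover_on c (arcType hw hk hc2 hwc 0) hc2
    (fun Bk : Block c => 2 ≤ bpot c (arcType hw hk hc2 hwc 0) Bk.out) (fun _ h => h) ∅ (by rw [Finset.coe_empty]; exact linearIndepOn_empty _ _)
    (fun f hf => absurd hf (Finset.notMem_empty f))
  set S₀ : Finset (CMF G c →₀ ℤ) := (Sc ∪ {gface c hc2 X₁ b t, gface c hc2 X₃ t t'}) ∪ Gs with hS₀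
  have hS₀f : (↑S₀ : Set (CMF G c →₀ ℤ)) ⊆ gfaceSet G c hc2 := by
    intro f hf
    rw [hS₀, coe_union, coe_union, Set.mem_union, Set.mem_union] at hf
    rcases hf with (hf | hf) | hf
    · exact hScf hf
    · rw [coe_insert, coe_singleton, Set.mem_insert_iff, Set.mem_singleton_iff] at hf
      rcases hf with rfl | rfl
      · exact ⟨X₁, b, t, htorb, rfl⟩
      · exact ⟨X₃, t, t', ht'orb, rfl⟩
    · rw [hGs, coe_image] at hf
      obtain ⟨j, -, rfl⟩ := hf
      exact ⟨_, t, t', ht'orb, rfl⟩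
  have hScS : Sc ⊆ S₀ := subset_union_left.trans subset_union_left
  have htw : ∀ Φ : CMF G c, 2 ≤ bpot c (arcType hw hk hc2 hwc 0) Φ → ∃ Q s s' : G, bpot c (arcType hw hk hc2 hwc 0) Φ = ddist (rt c Q (arcType hw hk hc2 hwc 0)) Φ ∧
      s ∈ (rt c Q (arcType hw hk hc2 hwc 0)).1 \ Φ.1 ∧ s' ∈ (rt c Q (arcType hw hk hc2 hwc 0)).1 \ Φ.1 ∧ s ≠ s' ∧
        gface c hc2 Φ s s' ∈ Submodule.span ℤ (pairSet c) ⊔ Submodule.span ℤ (translates c S₀) := by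
    intro Φ hΦ
    refine htwc _ ?_ Φ (by rw [bpot_out]; exact hΦ)
    exact (Submodule.span_mono fun y hy => by obtain ⟨Q, f, hf, e⟩ := hy; exact ⟨Q, f, hScS hf, e⟩).trans le_sup_right
  have hcov := fun Φ => hcov_of_toward c (arcType hw hk hc2 hwc 0) hc2 S₀ htw Φ
  -- the faces lie in `L`
  have hmemL : ∀ f ∈ S₀, f ∈ Submodule.span ℤ (pairSet c) ⊔ Submodule.span ℤ (translates c S₀) :=
    fun f hf => Submodule.mem_sup_right (mem_span_translates_of_mem c S₀ hf)
  have hf₁L := hmemL _ (by rw [hS₀]; exact mem_union_left _ (mem_union_right _ (mem_insert_self _ _)))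
  have hf₃L := hmemL _ (by rw [hS₀]; exact mem_union_left _ (mem_union_right _ (mem_insert_of_mem (mem_singleton_self _))))
  have hgL : ∀ j, 1 ≤ j → j ≤ 2 ^ (k - 1) - 2 → g j ∈ Submodule.span ℤ (pairSet c) ⊔ Submodule.span ℤ (translates c S₀) :=
    fun j hj1 hj2 => hmemL _ (by rw [hS₀, hGs]; exact mem_union_right _ (mem_image_of_mem _ (mem_Icc.mpr ⟨hj1, hj2⟩)))
  -- the near-zone relations
  have hR3 := rel_of_threeAcross hw hk hc2 hwc h1 _ htw hX₃ hB'F hsmall hlarge ht0 ht'0 htB ht'B htt' hf₃L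
  have hR1 := rel_of_oneAcross hw hk hc2 hwc h1 _ htw hb hX₁ hB'F hsmall hlarge ht0 htB hf₁L
  have hζt := zeta_mem_of_rels hw hk hc2 hwc _ ht hR3 hR1
  have hζ : ∀ s : G, w s = 0 → (Finsupp.single (oflipCM c hc2 s (arcType hw hk hc2 hwc 0)) (1 : ℤ) - Finsupp.single (arcType hw hk hc2 hwc 0) 1) + (Finsupp.single (oflipCM c hc2 s (arcType hw hk hc2 hwc 1)) (1 : ℤ) - Finsupp.single (arcType hw hk hc2 hwc 1) 1) ∈ Submodule.span ℤ (pairSet c) ⊔ Submodule.span ℤ (translates c S₀) :=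
    fun s hs => zeta_mem_of_zeta_mem hw hk hc2 hcen hwc S₀ ht0 hs hζt
  have hfib := fib_mem_of_rel hw hk hc2 hwc _ hB'F hR3 fun s hs => hζ s (mem_filter.mp (mem_sdiff.mp hs).1).2
  have hunit : ∀ j : ℕ, 1 ≤ j → j ≤ 2 ^ (k - 1) - 2 → ∃ u₀ : G, w u₀ = (j : ZMod (2 ^ k)) ∧
      (Finsupp.single (oflipCM c hc2 u₀ (arcType hw hk hc2 hwc 0)) (1 : ℤ) - Finsupp.single (arcType hw hk hc2 hwc 0) 1) - (Finsupp.single (oflipCM c hc2 u₀ (arcType hw hk hc2 hwc 1)) (1 : ℤ) - Finsupp.single (arcType hw hk hc2 hwc 1) 1) ∈ Submodule.span ℤ (pairSet c) ⊔ Submodule.span ℤ (translates c S₀) := by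
    intro j hj1 hj2
    obtain ⟨huT0, huT1, hu0, huX⟩ := hptT j hj1 hj2
    have hXu : (arcType hw hk hc2 hwc 0).1 \ (oflipCM c hc2 (pt j) X₃).1 = insert (pt j) B' := by rw [dev_oflip_of_mem c hc2 huT0 huX, hX₃]
    have hsp := rel_of_threeAcross_spectator hw hk hc2 hwc h1 _ htw hXu hB'F ⟨b, hb⟩ hmeq hu0 huT0 huT1 ht0 ht'0 htB ht'B htt'
      (hgL j hj1 hj2)
    exact ⟨pt j, hpt j, unitShift_mem_of_rels hw hk hc2 hwc _ hR3 hsp⟩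
  have hshift : ∀ s ∈ ((arcType hw hk hc2 hwc 0)).1,
      Finsupp.single (oflipCM c hc2 s (arcType hw hk hc2 hwc 0)) (1 : ℤ) - Finsupp.single (arcType hw hk hc2 hwc 0) 1 -
        Finsupp.single (oflipCM c hc2 s (arcType hw hk hc2 hwc (w s))) 1 + Finsupp.single (arcType hw hk hc2 hwc (w s)) 1 ∈
          Submodule.span ℤ (pairSet c) ⊔ Submodule.span ℤ (translates c S₀) := by
    intro s hs
    have hsv : (w s).val < 2 ^ (k - 1) := by have := (mem_arcType hw hk hc2 hwc 0 s).mp hs; rwa [sub_zero] at this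
    have hws : w s = (((w s).val : ℕ) : ZMod (2 ^ k)) := (ZMod.natCast_zmod_val (w s)).symm
    by_cases htop : (w s).val = 2 ^ (k - 1) - 1
    · have hu : w s = ((2 ^ (k - 1) : ℕ) : ZMod (2 ^ k)) - 1 := by
        rw [hws, htop, Nat.cast_sub (Nat.one_le_two_pow), Nat.cast_one]
      exact shiftTop_mem_of_zeta_mem hw hk hc2 hcen hwc S₀ ht0 hu hζt
    · have hle : (w s).val ≤ 2 ^ (k - 1) - 2 := by omega
      have h := shift_mem_of_unitShifts hw hk hc2 hcen hwc h1 S₀ (w s).val (fun j hj1 hj2 => hunit j hj1 (hj2.trans hle)) s hws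
      rwa [← hws] at h
  -- the count `|S₀| ≤ (β − 2ᵏ⁻¹ − 1) + 2 + (2ᵏ⁻¹ − 2) = φ₂`
  have hnear := half_add_one_le_card_filter_bpot_le_one hw hk hc2 hcen hwc h1 hn₀1 hn₀2 hn₀
  have hsplit := card_filter_add_card_filter_not (s := (univ : Finset (Block c))) (fun Bk : Block c => 2 ≤ bpot c (arcType hw hk hc2 hwc 0) Bk.out)
  have hneg : (univ.filter fun Bk : Block c => ¬ 2 ≤ bpot c (arcType hw hk hc2 hwc 0) Bk.out) = univ.filter fun Bk : Block c => bpot c (arcType hw hk hc2 hwc 0) Bk.out ≤ 1 :=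
    filter_congr fun Bk _ => by omega
  rw [hneg, card_univ] at hsplit
  have hcard : S₀.card ≤ fibreTwo c hc2 := by
    have h2 : ({gface c hc2 X₁ b t, gface c hc2 X₃ t t'} : Finset (CMF G c →₀ ℤ)).card ≤ 2 := card_insert_le _ _
    have hu := card_union_le Sc ({gface c hc2 X₁ b t, gface c hc2 X₃ t t'} : Finset (CMF G c →₀ ℤ))
    have hG : Gs.card ≤ 2 ^ (k - 1) - 2 := by rw [hGs]; exact card_image_le.trans (by rw [Nat.card_Icc]; omega)
    have hu2 := card_union_le (Sc ∪ {gface c hc2 X₁ b t, gface c hc2 X₃ t t'}) Gs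
    rw [← hS₀] at hu2
    rw [hScc] at hu
    omega
  exact (isLeast_card_gfaces_generate_of_shift hw hk hc2 hcen hwc h1 S₀ hS₀f hcard hcov hshift hfib).2

/-- **THE CYCLIC-SYLOW LAW, block form: `μ(G, c) = β(G, c) − 1`.** [folklore] -/
theorem isLeast_card_gfaces_generate_of_cyclic_card_block [Fintype (CMF G c)] (hw : ∀ P Q : G, w (P * Q) = w P + w Q) (hk : 1 ≤ k)
    (hk2 : 2 ≤ k) (hc2 : c * c = 1) (hcen : ∀ x : G, x * c = c * x) (hwc : w c ≠ 0) (h1 : ∃ g₁ : G, w g₁ = 1)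
    (hodd : ∀ g : G, w g = 0 → Odd (orderOf g)) {n₀ : G} (hn₀ : w n₀ = 0) (hn₀1 : n₀ ≠ 1) :
    IsLeast {n : ℕ | ∃ S : Finset (CMF G c →₀ ℤ), (↑S ⊆ gfaceSet G c hc2) ∧ S.card = n ∧
      hodgeSpan c hc2 ≤ Submodule.span ℤ (pairSet c) ⊔ Submodule.span ℤ (translates c S)} (Fintype.card (Block c) - 1) := by
  obtain ⟨h, hβ⟩ := isLeast_card_gfaces_generate_of_cyclic hw hk hk2 hc2 hcen hwc h1 hodd hn₀ hn₀1
  rw [← hβ, Nat.add_sub_cancel]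
  exact h

end

end Summit.HodgeConjecture.CorCM.Census.CyclicCharacter
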